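import Summits.ValiantsHypothesis.ValiantsHypothesis.Theorems.BarrierLeverPartitionMinorsSubsetSumVandermonde
import Summits.ValiantsHypothesis.ValiantsHypothesis.Theorems.BarrierLeverPartitionMinorsHitByVPAdditiveDoor

/-!
# Route BarrierLever — item `PartitionMinorsHitByVP` (stmt-ValiantsHypothesis-19717):
# SPLITTABLE row families × FACE column families are hit (assembly of engine and door)

Helper file (`--supports stmt-ValiantsHypothesis-19717`; cell valiant-natproofs, rung V4, 𝒟-side door (c),
prover seat val-np-p1). Closes NO item. Definition-free glue of two tree files:

* the ENGINE `SubsetSum.exists_det_ne_zero` (`…PartitionMinorsSubsetSumVandermonde`, this seat): if a row family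
  `u : (Fin κ → Bool) → Finset (Fin h)` is `IsSplittable κ` (recursively halved by affine functionals
  `U ↦ Σ_{k∈U} a_k − t`, each node with its OWN functional), then some numeric table `Γ₀, Γ` makes the
  subset-sum multilinear Vandermonde `[∏_{c : W c} (Γ₀ c + Σ_{k ∈ u i} Γ k c)]_{i, W}` nonsingular;
* the DOOR `AdditiveDoor.partitionMinor_hit_of_additive_mem` (val-np-p6 g3): a nonsingular table for the matrix
  `[∏_{c ∈ w j} (ω₀ c + Σ_{a ∈ u i} ω a c)]_{i,j}` puts the layout `(u, w)` inside `SmallCircuits ℂ (h+h) 5`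
  (`h ≥ 2`) with the item's matrix nonsingular (witness = the truncated additive / subset-sum polynomial
  `∏_c (1 + ω₀ c y_c) · ∏_a (1 + x_a ∏_c (1 + ω a c y_c))`, found independently by val-np-p6 g3, val-np-p3 g4
  and this seat, 2026-08-27).

**Theorem (`partitionMinor_hit_of_isSplittable_face`).** Let the columns form a FACE of the Boolean lattice:
`w W = W₀ ∪ T(W)` for an embedding `T : Fin κ ↪ Fin h` of block coordinates, a fixed set `W₀` avoiding the
block, and `W` ranging over ALL bit-vectors `Fin κ → Bool`; let the `2^κ` rows `u` be injective and
`IsSplittable κ`. Then the layout is hit inside `SmallCircuits ℂ (h+h) 5`. (Table: extend `Γ₀, Γ` by `1, 0`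
off the block, so the `W₀`-factors are `1`.) `partitionMinor_hit_of_isSplittable_face_fin` is the `Fin r`-indexed
form (rows/columns transported along `e : Fin r ≃ (Fin κ → Bool)`), matching the item's quantifier shape.

What remains for «ALL rows × face columns» is the HALVING / EVEN-SPLIT LEMMA (every `2^κ`-subset of `{0,1}^h`
is `IsSplittable κ`; owner val-np-p3 g4; numerics: no failure for `h ≤ 6`, kit j271111 / j270989), typed
Theorems-side per the director's ruling 2026-08-27T06:51Z. WHAT THIS IS NOT: nothing for non-face column
families; nothing on crux 14610.
-/

set_option linter.dupNamespace false

namespace Summit.ValiantsHypothesis.ValiantsHypothesis.Theorems.BarrierLever.SubsetSum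

open Finset MvPolynomial Literature.Barriers.ValiantsHypothesis
open Summit.ValiantsHypothesis.ValiantsHypothesis.Theorems.BarrierLever.AdditiveDoor
  (partitionMinor_hit_of_additive_mem)

noncomputable section

variable {h : ℕ}

/-- Extending a block table by `1` (shift) and `0` (rows) off the block turns the face-column product
`∏_{c ∈ W₀ ∪ T(W)}` into the block product `∏_{c : W c}`. -/
theorem prod_face_extend {κ : ℕ} (T : Fin κ ↪ Fin h) (W₀ : Finset (Fin h)) (hW₀ : ∀ c, T c ∉ W₀)
    (Γ₀ : Fin κ → ℂ) (Γ : Fin h → Fin κ → ℂ) (U : Finset (Fin h)) (W : Fin κ → Bool) :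
    ∏ c ∈ W₀ ∪ (univ.filter fun c => W c).map T,
        (Function.extend T Γ₀ (fun _ => (1 : ℂ)) c + ∑ k ∈ U, Function.extend T (Γ k) (fun _ => (0 : ℂ)) c) =
      ∏ c : Fin κ, if W c then (Γ₀ c + ∑ k ∈ U, Γ k c) else 1 := by
  have hdisj : Disjoint W₀ ((univ.filter fun c => W c).map T) := by
    rw [Finset.disjoint_left]
    intro c hc hc'
    obtain ⟨c', -, rfl⟩ := Finset.mem_map.mp hc'
    exact hW₀ c' hc
  rw [Finset.prod_union hdisj, Finset.prod_map, Finset.prod_filter]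
  have h1 : ∏ c ∈ W₀, (Function.extend T Γ₀ (fun _ => (1 : ℂ)) c +
      ∑ k ∈ U, Function.extend T (Γ k) (fun _ => (0 : ℂ)) c) = 1 := by
    refine Finset.prod_eq_one fun c hc => ?_
    have hnot : ¬ ∃ c', T c' = c := fun ⟨c', hc'⟩ => hW₀ c' (hc' ▸ hc)
    rw [Function.extend_apply' _ _ _ hnot]
    simp [Function.extend_apply' _ _ _ hnot]
  rw [h1, one_mul]
  refine Finset.prod_congr rfl fun c _ => ?_
  split_ifs
  · simp [T.injective.extend_apply]
  · rfl

/-- **SPLITTABLE rows × FACE columns are hit** (bit-vector-indexed form). -/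
theorem partitionMinor_hit_of_isSplittable_face (hh : 2 ≤ h) {κ : ℕ}
    (u : (Fin κ → Bool) → Finset (Fin h)) (hu : Function.Injective u) (hs : IsSplittable κ (univ.image u))
    (T : Fin κ ↪ Fin h) (W₀ : Finset (Fin h)) (hW₀ : ∀ c, T c ∉ W₀) :
    ∃ f ∈ SmallCircuits ℂ (h + h) 5,
      (Matrix.of fun i j : Fin κ → Bool => MvPolynomial.coeff
        (∑ a ∈ u i, Finsupp.single (Fin.castAdd h a) 1 +
          ∑ c ∈ W₀ ∪ (univ.filter fun c => j c).map T, Finsupp.single (Fin.natAdd h c) 1) f).det ≠ 0 := by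
  obtain ⟨Γ₀, Γ, hdet⟩ := exists_det_ne_zero κ u hu hs
  refine partitionMinor_hit_of_additive_mem h hh u (fun j => W₀ ∪ (univ.filter fun c => j c).map T)
    (Function.extend T Γ₀ fun _ => 1) (fun k => Function.extend T (Γ k) fun _ => 0) ?_
  have hmat : (Matrix.of fun i j : Fin κ → Bool => ∏ c ∈ W₀ ∪ (univ.filter fun c => j c).map T,
        (Function.extend T Γ₀ (fun _ => (1 : ℂ)) c +
          ∑ k ∈ u i, Function.extend T (Γ k) (fun _ => (0 : ℂ)) c)) =
      Matrix.of fun i j : Fin κ → Bool => ∏ c : Fin κ, if j c then (Γ₀ c + ∑ k ∈ u i, Γ k c) else 1 := by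
    ext i j
    exact prod_face_extend T W₀ hW₀ Γ₀ Γ (u i) j
  rw [hmat]
  exact hdet

/-- **SPLITTABLE rows × FACE columns are hit** (`Fin r`-indexed form, the item's quantifier shape): rows
`u : Fin r → Finset (Fin h)` injective whose image is `IsSplittable κ`, columns `w j = W₀ ∪ T(e j)` along a
bijection `e : Fin r ≃ (Fin κ → Bool)`. -/
theorem partitionMinor_hit_of_isSplittable_face_fin (hh : 2 ≤ h) {κ r : ℕ} (e : Fin r ≃ (Fin κ → Bool))
    (u w : Fin r → Finset (Fin h)) (hu : Function.Injective u) (hs : IsSplittable κ (univ.image u))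
    (T : Fin κ ↪ Fin h) (W₀ : Finset (Fin h)) (hW₀ : ∀ c, T c ∉ W₀)
    (hw : ∀ j, w j = W₀ ∪ (univ.filter fun c => e j c).map T) :
    ∃ f ∈ SmallCircuits ℂ (h + h) 5,
      (Matrix.of fun i j : Fin r => MvPolynomial.coeff
        (∑ a ∈ u i, Finsupp.single (Fin.castAdd h a) 1 +
          ∑ c ∈ w j, Finsupp.single (Fin.natAdd h c) 1) f).det ≠ 0 := by
  -- transport the row family along `e`
  have hu' : Function.Injective (fun i : Fin κ → Bool => u (e.symm i)) :=
    fun i j hij => e.symm.injective (hu hij)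
  have himg : univ.image (fun i : Fin κ → Bool => u (e.symm i)) = univ.image u := by
    ext U
    simp only [mem_image, mem_univ, true_and]
    constructor
    · rintro ⟨i, rfl⟩; exact ⟨_, rfl⟩
    · rintro ⟨i, rfl⟩; exact ⟨e i, by simp⟩
  obtain ⟨f, hf, hdet⟩ := partitionMinor_hit_of_isSplittable_face hh (fun i => u (e.symm i)) hu'
    (himg ▸ hs) T W₀ hW₀
  refine ⟨f, hf, ?_⟩
  have hmat : (Matrix.of fun i j : Fin r => MvPolynomial.coeff
        (∑ a ∈ u i, Finsupp.single (Fin.castAdd h a) 1 +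
          ∑ c ∈ w j, Finsupp.single (Fin.natAdd h c) 1) f) =
      (Matrix.of fun i j : Fin κ → Bool => MvPolynomial.coeff
        (∑ a ∈ u (e.symm i), Finsupp.single (Fin.castAdd h a) 1 +
          ∑ c ∈ W₀ ∪ (univ.filter fun c => j c).map T, Finsupp.single (Fin.natAdd h c) 1) f).submatrix
        e e := by
    ext i j
    simp [Matrix.submatrix_apply, hw j]
  rw [hmat, Matrix.det_submatrix_equiv_self]
  exact hdet

end

end Summit.ValiantsHypothesis.ValiantsHypothesis.Theorems.BarrierLever.SubsetSum
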